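import Mathlib
import HarnessLib
import Summits.ResolutionOfSingularities.ResolutionOfSingularities.Theorems.WildQuotientsWildQuotientResolutionS1aA1Root

/-!
# S1a — INSTANCE I-3 (D₄), ring level, MOVE 2 of MT-D₄ (v1.1): on the (re-coordinated) model ring of `N(x₁)` the (1,1)-centre `(z′, X₀′)` is admissible relative
# to `β = s`, and its residual ideal contains `Y₀` and `X₁′·Z′·(Z′s₂ + s·X₁′)`

[OURS · L1 W4.5c · lead-1 g13; plan-1 RULING R-F15e (I-3 := MT-D₄ v1.1 move-by-move in the I-2 architecture), X-CERT v1.1 §2 / v1.2-D4ROWS §1 move 2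
«centre (z:1, X₀′:1); chart [X₀′] KILLED, chart [z] RESIDUAL core (X₀″, x₂)», FRAME-STATUS rev16 §3] — NOT statements of the manuscript; counted 0; AI-level
work, weaker than expert review. Crux stmt-ResolutionOfSingularities-17941 `CyclicQuotientFourfolds`, line `s1a-logminvertex` v13 (`stub_reachLowerInFX`).

ABSTRACT SETTING (lead-1's coordinates; the model ring of `N(x₁)` after move 1 AND the triangular recoordination `z′ := x₂ − s·X₁′` of ✓`…S1aRecoordStep`):
a commutative ring `P` with elements `s` (exceptional parameter of move 1), `X₀` (= `x₀T²`), `X₁` (= `x₁T`, a unit on the chart), `z` (= `x₂ − sX₁`, `τ`-FIXED)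
and `x₃`, and an automorphism `τ` with rows `τ s = s`, `τ X₀ = X₀`, `τ X₁ = X₁ + X₀·s`, `τ z = z`, `τ x₃ = x₃ − s·X₁·z·(z + s·X₁)` (= `x₃ + x₁x₂(x₁ − x₂)` rewritten:
`x₁ = sX₁`, `x₂ = z + sX₁`), all further ring generators `τ`-fixed. Centre `(z, X₀)`, weights `(1, 1)`, `β = s`, shift 1. On `R^w(P) = P[s₂, Z = zT, Y = X₀T]`:
* `d4m2_admissible`, `d4m2_map_le` — (a′)₁ relative to `β = s`;
* ★ `d4m2_augmentationIdeal_sigmaR_le` — (H1): `aug σ_R ≤ (s·s₂)`;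
* `d4m2_sigmaR_X₁_sub` (`σ_R X₁ − X₁ = (s s₂)·Y`), `d4m2_sigmaR_x₃_sub` (`σ_R x₃ − x₃ = (s s₂)·(−X₁ Z (Z s₂ + s X₁))`);
* ★ `d4m2_residual_mem` — `Y ∈ 𝔞₂` and `X₁·Z·(Z s₂ + s X₁) ∈ 𝔞₂` (`𝔞₂ = (aug σ_R : s s₂)`): on the `[X₀]` chart (`Y` a unit) the residual is EMPTY (killed); on the
  `[z]` chart (`Z`, `X₁` units) it is `V(Y, Z s₂ + s X₁) = V(Y, x₂)` — X-CERT's core `(X₀″, x₂)`.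
-/

set_option linter.dupNamespace false

noncomputable section

open Literature.AlgebraicGeometry.Resolution
open scoped LaurentPolynomial
open Summit.ResolutionOfSingularities.ResolutionOfSingularities.Theorems.WildQuotientResolution.S1.CoarseChart
open Summit.ResolutionOfSingularities.ResolutionOfSingularities.Theorems.WildQuotientResolution.S1.BlowupCharts

namespace Summit.ResolutionOfSingularities.ResolutionOfSingularities.Theorems.WildQuotientResolution.S1.KillCert.D4

variable {P : Type} [CommRing P] (τ : P ≃+* P) (s X₀ X₁ z x₃ : P) (Gfix : Set P)
  (hs : τ s = s) (hX₀ : τ X₀ = X₀) (hX₁ : τ X₁ = X₁ + X₀ * s) (hz : τ z = z) (hx₃ : τ x₃ = x₃ - s * X₁ * z * (z + s * X₁))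
  (hfix : ∀ g ∈ Gfix, τ g = g) (hgen : Subring.closure (({s, X₀, X₁, z, x₃} : Set P) ∪ Gfix) = ⊤)

/-! ## (a′)₁ relative to `β = s` -/

include hs hX₀ hX₁ hz hx₃ hfix hgen in
/-- **(a′)₁ for move 2 of MT-D₄**: `y ∈ 𝒥ₙ((z, X₀), (1,1)) ⇒ τ y − y ∈ (s)·𝒥ₙ₊₁`. [OURS · L1 W4.5c · R-F15e move 2] -/
theorem d4m2_admissible : ∀ (n : ℕ) (y : P), y ∈ (weightedFiltration (![z, X₀] : Fin 2 → P) ![1, 1]).ideal n →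
    τ y - y ∈ Ideal.span {s} * (weightedFiltration (![z, X₀] : Fin 2 → P) ![1, 1]).ideal (n + 1) := by
  intro n y hy
  have hJ0 : z ∈ (weightedFiltration (![z, X₀] : Fin 2 → P) ![1, 1]).ideal 1 := mem_weightedFiltration_ideal (![z, X₀] : Fin 2 → P) ![1, 1] 0
  have hJ1 : X₀ ∈ (weightedFiltration (![z, X₀] : Fin 2 → P) ![1, 1]).ideal 1 := mem_weightedFiltration_ideal (![z, X₀] : Fin 2 → P) ![1, 1] 1
  have hsJ : ∀ {m : ℕ} {y : P}, y ∈ (weightedFiltration (![z, X₀] : Fin 2 → P) ![1, 1]).ideal m →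
      s * y ∈ Ideal.span {s} * (weightedFiltration (![z, X₀] : Fin 2 → P) ![1, 1]).ideal m :=
    fun hy => Ideal.mul_mem_mul (Ideal.mem_span_singleton_self s) hy
  have h0 : ∀ m : ℕ, (0 : P) ∈ Ideal.span {s} * (weightedFiltration (![z, X₀] : Fin 2 → P) ![1, 1]).ideal m := fun m => Ideal.zero_mem _
  have m_X₁ : τ X₁ - X₁ ∈ Ideal.span {s} * (weightedFiltration (![z, X₀] : Fin 2 → P) ![1, 1]).ideal 1 := by
    rw [hX₁, show X₁ + X₀ * s - X₁ = s * X₀ by ring]; exact hsJ hJ1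
  have m_x₃ : τ x₃ - x₃ ∈ Ideal.span {s} * (weightedFiltration (![z, X₀] : Fin 2 → P) ![1, 1]).ideal 1 := by
    rw [hx₃, show x₃ - s * X₁ * z * (z + s * X₁) - x₃ = s * (-(X₁ * (z + s * X₁)) * z) by ring]
    exact hsJ (Ideal.mul_mem_left _ _ hJ0)
  refine admissible_of_generators (![z, X₀] : Fin 2 → P) ![1, 1] τ s _ hgen ?_ ?_ n y hy
  · rintro g (hg | hg)
    · simp only [Set.mem_insert_iff, Set.mem_singleton_iff] at hg
      rcases hg with rfl | rfl | rfl | rfl | rfl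
      · rw [hs, sub_self]; exact h0 1
      · rw [hX₀, sub_self]; exact h0 1
      · exact m_X₁
      · rw [hz, sub_self]; exact h0 1
      · exact m_x₃
    · rw [hfix g hg, sub_self]; exact h0 1
  · intro i
    fin_cases i
    · change τ z - z ∈ Ideal.span {s} * (weightedFiltration (![z, X₀] : Fin 2 → P) ![1, 1]).ideal (1 + 1)
      rw [hz, sub_self]; exact h0 2
    · change τ X₀ - X₀ ∈ Ideal.span {s} * (weightedFiltration (![z, X₀] : Fin 2 → P) ![1, 1]).ideal (1 + 1)
      rw [hX₀, sub_self]; exact h0 2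

include hs hX₀ hX₁ hz hx₃ hfix hgen in
/-- **`τ`-stability** of the move-2 filtration. -/
theorem d4m2_map_le : ∀ n : ℕ,
    ((weightedFiltration (![z, X₀] : Fin 2 → P) ![1, 1]).ideal n).map (τ : P →+* P) ≤ (weightedFiltration (![z, X₀] : Fin 2 → P) ![1, 1]).ideal n :=
  fun n => map_le_of_admissible (![z, X₀] : Fin 2 → P) ![1, 1] τ s (d4m2_admissible τ s X₀ X₁ z x₃ Gfix hs hX₀ hX₁ hz hx₃ hfix hgen) n

/-! ## (H1) and the residual ideal -/

section Residual

variable {p : ℕ} (hp : 0 < p) (hσp : ∀ x : P, (⇑τ)^[p] x = x)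

include hs hX₀ hX₁ hz hx₃ hfix hgen in
/-- ★ **(H1) for move 2 of MT-D₄**: on `R^w(P) = P[s₂, zT, X₀T]`, `aug σ_R ≤ (s · s₂)`. -/
theorem d4m2_augmentationIdeal_sigmaR_le :
    augmentationIdeal (sigmaR τ (![z, X₀] : Fin 2 → P) ![1, 1] (d4m2_map_le τ s X₀ X₁ z x₃ Gfix hs hX₀ hX₁ hz hx₃ hfix hgen) hp hσp) ≤
      Ideal.span {algebraMap P _ s * cobordantAlgebra.s (![z, X₀] : Fin 2 → P) ![1, 1]} :=
  augmentationIdeal_sigmaR_le_span_of_admissible (![z, X₀] : Fin 2 → P) ![1, 1] τ _ hp hσp s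
    (d4m2_admissible τ s X₀ X₁ z x₃ Gfix hs hX₀ hX₁ hz hx₃ hfix hgen)

include hX₁ in
/-- Row of `X₁`: `σ_R X₁ − X₁ = X₀·s = (s s₂)·Y` (`Y = X₀T`). -/
theorem d4m2_sigmaR_X₁_sub
    (hσJ : ∀ n : ℕ, ((weightedFiltration (![z, X₀] : Fin 2 → P) ![1, 1]).ideal n).map (τ : P →+* P) ≤ (weightedFiltration (![z, X₀] : Fin 2 → P) ![1, 1]).ideal n) :
    sigmaR τ (![z, X₀] : Fin 2 → P) ![1, 1] hσJ hp hσp (algebraMap P _ X₁) - algebraMap P _ X₁ =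
      (algebraMap P _ s * cobordantAlgebra.s (![z, X₀] : Fin 2 → P) ![1, 1]) * cobordantAlgebra.u' (![z, X₀] : Fin 2 → P) ![1, 1] 1 := by
  refine Subtype.ext ?_
  rw [AddSubgroupClass.coe_sub, MulMemClass.coe_mul, MulMemClass.coe_mul, sigmaR_algebraMap, cobordantAlgebra.coe_algebraMap,
    cobordantAlgebra.coe_algebraMap, cobordantAlgebra.coe_algebraMap, cobordantAlgebra.coe_s, cobordantAlgebra.coe_u']
  change LaurentPolynomial.C (τ X₁) - LaurentPolynomial.C X₁ =
    LaurentPolynomial.C s * LaurentPolynomial.T (-1) * (LaurentPolynomial.C X₀ * LaurentPolynomial.T ((1 : ℕ) : ℤ))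
  rw [hX₁, map_add, map_mul]
  have hT : LaurentPolynomial.T (-1) * LaurentPolynomial.T ((1 : ℕ) : ℤ) = (1 : P[T;T⁻¹]) := by
    rw [← LaurentPolynomial.T_add]; norm_num
  calc LaurentPolynomial.C X₁ + LaurentPolynomial.C X₀ * LaurentPolynomial.C s - LaurentPolynomial.C X₁
      = LaurentPolynomial.C X₀ * LaurentPolynomial.C s * (LaurentPolynomial.T (-1) * LaurentPolynomial.T ((1 : ℕ) : ℤ)) := by rw [hT]; ring
    _ = _ := by ring

include hx₃ in
/-- Row of `x₃`: `σ_R x₃ − x₃ = −s·X₁·z·(z + sX₁) = (s s₂)·(−X₁·Z·(Z s₂ + s X₁))` (`Z = zT`, `z = Z s₂`). -/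
theorem d4m2_sigmaR_x₃_sub
    (hσJ : ∀ n : ℕ, ((weightedFiltration (![z, X₀] : Fin 2 → P) ![1, 1]).ideal n).map (τ : P →+* P) ≤ (weightedFiltration (![z, X₀] : Fin 2 → P) ![1, 1]).ideal n) :
    sigmaR τ (![z, X₀] : Fin 2 → P) ![1, 1] hσJ hp hσp (algebraMap P _ x₃) - algebraMap P _ x₃ =
      (algebraMap P _ s * cobordantAlgebra.s (![z, X₀] : Fin 2 → P) ![1, 1]) *
        -(algebraMap P _ X₁ * cobordantAlgebra.u' (![z, X₀] : Fin 2 → P) ![1, 1] 0 *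
          (cobordantAlgebra.u' (![z, X₀] : Fin 2 → P) ![1, 1] 0 * cobordantAlgebra.s (![z, X₀] : Fin 2 → P) ![1, 1] + algebraMap P _ s * algebraMap P _ X₁)) := by
  refine Subtype.ext ?_
  rw [AddSubgroupClass.coe_sub, MulMemClass.coe_mul, NegMemClass.coe_neg, MulMemClass.coe_mul, MulMemClass.coe_mul, MulMemClass.coe_mul, AddMemClass.coe_add,
    MulMemClass.coe_mul, MulMemClass.coe_mul, sigmaR_algebraMap, cobordantAlgebra.coe_algebraMap, cobordantAlgebra.coe_algebraMap, cobordantAlgebra.coe_algebraMap,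
    cobordantAlgebra.coe_algebraMap, cobordantAlgebra.coe_s, cobordantAlgebra.coe_u']
  change LaurentPolynomial.C (τ x₃) - LaurentPolynomial.C x₃ =
    LaurentPolynomial.C s * LaurentPolynomial.T (-1) * -(LaurentPolynomial.C X₁ * (LaurentPolynomial.C z * LaurentPolynomial.T ((1 : ℕ) : ℤ)) *
      (LaurentPolynomial.C z * LaurentPolynomial.T ((1 : ℕ) : ℤ) * LaurentPolynomial.T (-1) + LaurentPolynomial.C s * LaurentPolynomial.C X₁))
  rw [hx₃]
  simp only [map_sub, map_add, map_mul]
  have hT : LaurentPolynomial.T (-1) * LaurentPolynomial.T ((1 : ℕ) : ℤ) = (1 : P[T;T⁻¹]) := by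
    rw [← LaurentPolynomial.T_add]; norm_num
  calc _ = -(LaurentPolynomial.C s * LaurentPolynomial.C X₁ * LaurentPolynomial.C z * (LaurentPolynomial.T (-1) * LaurentPolynomial.T ((1 : ℕ) : ℤ)) *
        (LaurentPolynomial.C z * (LaurentPolynomial.T (-1) * LaurentPolynomial.T ((1 : ℕ) : ℤ)) + LaurentPolynomial.C s * LaurentPolynomial.C X₁)) := by
        rw [hT]; ring
    _ = _ := by ring

include hs hX₀ hX₁ hz hx₃ hfix hgen in
/-- ★ **`Y ∈ 𝔞₂`** and ★ **`X₁·Z·(Z s₂ + s X₁) ∈ 𝔞₂`** — the residual ideal `(aug σ_R : s·s₂)` of move 2: the `[X₀]` chart (`Y` a unit) is KILLED, on the `[z]` chart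
(`Z`, `X₁` units) the residual is `V(Y, Z s₂ + s X₁) = V(Y, x₂)`. [OURS · L1 W4.5c · X-CERT v1.2-D4ROWS move 2] -/
theorem d4m2_residual_mem :
    cobordantAlgebra.u' (![z, X₀] : Fin 2 → P) ![1, 1] 1 ∈
        (augmentationIdeal (sigmaR τ (![z, X₀] : Fin 2 → P) ![1, 1] (d4m2_map_le τ s X₀ X₁ z x₃ Gfix hs hX₀ hX₁ hz hx₃ hfix hgen) hp hσp)).colon
          (Ideal.span {algebraMap P _ s * cobordantAlgebra.s (![z, X₀] : Fin 2 → P) ![1, 1]}) ∧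
      algebraMap P _ X₁ * cobordantAlgebra.u' (![z, X₀] : Fin 2 → P) ![1, 1] 0 *
          (cobordantAlgebra.u' (![z, X₀] : Fin 2 → P) ![1, 1] 0 * cobordantAlgebra.s (![z, X₀] : Fin 2 → P) ![1, 1] + algebraMap P _ s * algebraMap P _ X₁) ∈
        (augmentationIdeal (sigmaR τ (![z, X₀] : Fin 2 → P) ![1, 1] (d4m2_map_le τ s X₀ X₁ z x₃ Gfix hs hX₀ hX₁ hz hx₃ hfix hgen) hp hσp)).colon
          (Ideal.span {algebraMap P _ s * cobordantAlgebra.s (![z, X₀] : Fin 2 → P) ![1, 1]}) := by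
  refine ⟨?_, ?_⟩
  · rw [Ideal.mem_colon_span_singleton, mul_comm, ← d4m2_sigmaR_X₁_sub τ s X₀ X₁ z hX₁ hp hσp]
    exact sub_mem_augmentationIdeal _ _
  · rw [Ideal.mem_colon_span_singleton]
    have h := neg_mem (sub_mem_augmentationIdeal
      (sigmaR τ (![z, X₀] : Fin 2 → P) ![1, 1] (d4m2_map_le τ s X₀ X₁ z x₃ Gfix hs hX₀ hX₁ hz hx₃ hfix hgen) hp hσp) (algebraMap P _ x₃))
    rw [d4m2_sigmaR_x₃_sub τ s X₀ X₁ z x₃ hx₃ hp hσp] at h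
    convert h using 1
    ring

end Residual

end Summit.ResolutionOfSingularities.ResolutionOfSingularities.Theorems.WildQuotientResolution.S1.KillCert.D4

end
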